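import Summits.AnomalousDissipation.AnomalousDissipation.Theorems.WazewskiBlockSubLaminarObliqueClass

/-!
# Route `WazewskiBlock`, item stmt-AnomalousDissipation-10354 — the oblique class, II: the laminar
# zero and the invariance of the class

* `galerkinRHS_laminarCoord`, `obliqueField_laminarCoord` — the laminar Kolmogorov state
  `A sin(4πx₁)e₀`, `A = F/(16π²ν)`, is a zero of every Galerkin system of order `N ≥ 2`
  (`νΔu + f = 0`, no self-advection), hence of `obliqueField`;
* purely imaginary data stay purely imaginary under the Galerkin field, lattice-supported data stay
  lattice supported (`galerkinRHS_obliqueCoeff_eq_zero`), and a purely imaginary real transversal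
  lattice-supported vector is `Φ` of its coordinates (`obliqueCoeff_obliqueCoord`): the oblique
  class is invariant (`obliqueCoeff_obliqueCoord_galerkinRHS`) and zeros of `obliqueField` are
  stationary Galerkin states (`galerkinRHS_eq_zero_of_obliqueField_eq_zero`).

All statements proved; no definitions.
-/

noncomputable section

-- `Summit.<Summit>.<Problem>` is the tree's mandated summit-side namespace (CONVENTIONS §2); deliberate duplicate.
set_option linter.dupNamespace false

open scoped InnerProductSpace ComplexConjugate
open Finset
open Literature.Analysis.FunctionSpaces Literature.Analysis.FunctionSpaces.Torus
open Literature.Analysis.FluidPDE Literature.Analysis.FluidPDE.Torus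

namespace Summit.AnomalousDissipation.AnomalousDissipation.Theorems.Oblique
/-! ### The laminar state is a zero of the Galerkin field -/

/-- A termwise-vanishing convection symbol vanishes. [folklore] -/
theorem convectionCoeff_eq_zero_of_forall {S : Finset (Fin 3 → ℤ)} {c c' : (Fin 3 → ℤ) → EuclideanSpace ℂ (Fin 3)}
    {k : Fin 3 → ℤ}
    (h : ∀ l ∈ S, ∀ m ∈ S, l + m = k → (∑ j, c l j * (m j : ℂ)) • c' m = 0) :
    convectionCoeff S c c' k = 0 := by
  rw [convectionCoeff_def]
  refine Finset.sum_eq_zero fun l hl => Finset.sum_eq_zero fun m hm => ?_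
  split_ifs with hlm
  · rw [mul_smul, h l hl m hm hlm, smul_zero]
  · rfl

/-- The vector `i e₀ ∈ ℂ³` (direction of the laminar coefficients and of the force). [folklore] -/
theorem I_smul_complexify_single_apply (j : Fin 3) :
    (Complex.I • EuclideanSpace.complexify (EuclideanSpace.single (0 : Fin 3) (1 : ℝ))) j =
      if j = 0 then Complex.I else 0 := by
  fin_cases j <;> simp [EuclideanSpace.complexify_apply]

/-- `i e₀` is transversal to `±e`. [folklore] -/
theorem sum_modeE_mul_I_smul (a : ℂ) (s : ℤ) :
    ∑ j, (((s • modeE) j : ℤ) : ℂ) *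
      (a • (Complex.I • EuclideanSpace.complexify (EuclideanSpace.single (0 : Fin 3) (1 : ℝ)))) j = 0 := by
  simp [Fin.sum_univ_three, modeE_apply_zero, modeE_apply_one, modeE_apply_two]

/-- The extended laminar coefficients have vanishing `x₁`-components. [folklore] -/
theorem coeffExt_obliqueCoeff_laminarCoord_apply_one {N : ℕ} (ν F : ℝ) (hN : 2 ≤ N) (l : Fin 3 → ℤ) :
    coeffExt (freqBall (d := Fin 3) N) (obliqueCoeff N (laminarCoord ν F N)) l 1 = 0 := by
  by_cases hl : l ∈ freqBall (d := Fin 3) N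
  · rw [coeffExt_of_mem _ hl, obliqueCoeff_laminarCoord ν F hN]
    split_ifs <;> simp
  · rw [coeffExt_of_not_mem _ hl]; rfl

/-- **The laminar shear does not advect itself**: the convection symbol of the laminar
coefficients vanishes identically (`û(l) ∥ e₀ ⊥ e`). [folklore] -/
theorem convectionCoeff_laminar {N : ℕ} (ν F : ℝ) (hN : 2 ≤ N) (k : Fin 3 → ℤ) :
    convectionCoeff (freqBall (d := Fin 3) N)
      (coeffExt (freqBall (d := Fin 3) N) (obliqueCoeff N (laminarCoord ν F N)))
      (coeffExt (freqBall (d := Fin 3) N) (obliqueCoeff N (laminarCoord ν F N))) k = 0 := by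
  refine convectionCoeff_eq_zero_of_forall fun l _ m hm _ => ?_
  rw [coeffExt_of_mem _ hm, obliqueCoeff_laminarCoord ν F hN ⟨m, hm⟩]
  have h1 := coeffExt_obliqueCoeff_laminarCoord_apply_one ν F hN l
  simp only
  split_ifs with hme hme'
  · have : ∑ j, coeffExt (freqBall (d := Fin 3) N) (obliqueCoeff N (laminarCoord ν F N)) l j * ((m j : ℤ) : ℂ) = 0 := by
      simp [Fin.sum_univ_three, hme, modeE_apply_zero, modeE_apply_one, modeE_apply_two, h1]
    rw [this, zero_smul]
  · have : ∑ j, coeffExt (freqBall (d := Fin 3) N) (obliqueCoeff N (laminarCoord ν F N)) l j * ((m j : ℤ) : ℂ) = 0 := by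
      simp [Fin.sum_univ_three, hme', modeE_apply_zero, modeE_apply_one, modeE_apply_two, h1]
    rw [this, zero_smul]
  · rw [smul_zero]

/-- **The laminar state is a stationary solution of every Galerkin system of order `N ≥ 2`:**
`galerkinRHS (freqBall N) ν f̂ û_lam = 0` (`νΔu_lam + f = 0`, `(u_lam·∇)u_lam = 0`). [folklore] -/
theorem galerkinRHS_laminarCoord {ν : ℝ} (hν : ν ≠ 0) (F : ℝ) {N : ℕ} (hN : 2 ≤ N) :
    galerkinRHS (freqBall (d := Fin 3) N) ν (kolmogorovCoeff F N) (obliqueCoeff N (laminarCoord ν F N)) = 0 := by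
  funext k
  rw [galerkinRHS_apply, galerkinField_def, convectionCoeff_laminar ν F hN, sub_zero, Pi.zero_apply,
    coeffExt_of_mem _ k.2, coeffExt_of_mem _ k.2, obliqueCoeff_laminarCoord ν F hN]
  set w : EuclideanSpace ℂ (Fin 3) :=
    Complex.I • EuclideanSpace.complexify (EuclideanSpace.single (0 : Fin 3) (1 : ℝ)) with hw
  have hπ : ((Real.pi : ℝ) : ℂ) ≠ 0 := Complex.ofReal_ne_zero.2 Real.pi_ne_zero
  have hνC : ((ν : ℝ) : ℂ) ≠ 0 := Complex.ofReal_ne_zero.2 hν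
  simp only [kolmogorovCoeff]
  by_cases h1 : (k : Fin 3 → ℤ) = modeE
  · rw [if_pos h1, if_pos h1]
    have htr : ∑ j, (((k : Fin 3 → ℤ) j : ℤ) : ℂ) * (-(((F / 2 : ℝ) : ℂ) • w)) j = 0 := by
      have := sum_modeE_mul_I_smul (-((F / 2 : ℝ) : ℂ)) 1
      simpa [h1, hw, neg_smul] using this
    rw [leraySym_of_transversal htr, freqNormSq, show (∑ i, ((k : Fin 3 → ℤ) i : ℝ) ^ 2) = 4 by
      rw [h1]; exact freqNormSq_modeE]
    rw [← Complex.coe_smul, smul_smul, ← neg_smul, ← neg_smul, ← add_smul]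
    convert zero_smul ℂ w using 2
    push_cast
    field_simp
    ring
  · rw [if_neg h1, if_neg h1]
    by_cases h2 : (k : Fin 3 → ℤ) = -modeE
    · rw [if_pos h2, if_pos h2]
      have htr : ∑ j, (((k : Fin 3 → ℤ) j : ℤ) : ℂ) * (((F / 2 : ℝ) : ℂ) • w) j = 0 := by
        have := sum_modeE_mul_I_smul ((F / 2 : ℝ) : ℂ) (-1)
        simpa [h2, hw] using this
      rw [leraySym_of_transversal htr, freqNormSq, show (∑ i, ((k : Fin 3 → ℤ) i : ℝ) ^ 2) = 4 by
        rw [h2, ← freqNormSq, freqNormSq_neg]; exact freqNormSq_modeE]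
      rw [← Complex.coe_smul, smul_smul, ← neg_smul, ← add_smul]
      convert zero_smul ℂ w using 2
      push_cast
      field_simp
      ring
    · rw [if_neg h2, if_neg h2, smul_zero, neg_zero, leraySym_zero, add_zero]

/-- **The laminar coordinates are a zero of `obliqueField`.** [folklore] -/
theorem obliqueField_laminarCoord {ν : ℝ} (hν : ν ≠ 0) (F : ℝ) {N : ℕ} (hN : 2 ≤ N) :
    obliqueField ν F N (laminarCoord ν F N) = 0 := by
  rw [obliqueField_apply, galerkinRHS_laminarCoord hν F hN]
  funext p
  simp [obliqueCoord]

/-! ### Purely imaginary vectors and the invariance of the oblique class -/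

/-- `Φ x` is purely imaginary. [folklore] -/
theorem obliqueCoeff_re {N : ℕ} (x : ObliqueIndex N → ℝ) (k : ↥(freqBall (d := Fin 3) N)) (j : Fin 3) :
    (obliqueCoeff N x k j).re = 0 := by
  by_cases hk : (k : Fin 3 → ℤ) ∈ obliqueReps N
  · rw [obliqueCoeff_apply_of_mem x hk]; simp [EuclideanSpace.complexify_apply]
  · by_cases hk' : -(k : Fin 3 → ℤ) ∈ obliqueReps N
    · rw [obliqueCoeff_apply_of_neg_mem x hk']; simp [EuclideanSpace.complexify_apply]
    · rw [obliqueCoeff_apply_of_not_mem x fun h => (mem_obliqueReps_or_neg_mem h).elim hk hk']; rfl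

/-- The Kolmogorov force coefficients are purely imaginary. [folklore] -/
theorem kolmogorovCoeff_re (F : ℝ) {N : ℕ} (k : ↥(freqBall (d := Fin 3) N)) (j : Fin 3) :
    (kolmogorovCoeff F N k j).re = 0 := by
  simp only [kolmogorovCoeff]
  split_ifs <;> simp [EuclideanSpace.complexify_apply]

/-- The Kolmogorov force coefficients are supported on `±e`. [folklore] -/
theorem kolmogorovCoeff_eq_zero (F : ℝ) {N : ℕ} {k : ↥(freqBall (d := Fin 3) N)}
    (h1 : (k : Fin 3 → ℤ) ≠ modeE) (h2 : (k : Fin 3 → ℤ) ≠ -modeE) : kolmogorovCoeff F N k = 0 := by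
  simp [kolmogorovCoeff, h1, h2]

/-- `±e` are lattice modes (`N ≥ 2`). [folklore] -/
theorem modeE_mem_obliqueModes {N : ℕ} (hN : 2 ≤ N) : modeE ∈ obliqueModes N :=
  obliqueReps_subset N (modeE_mem_obliqueReps hN)

/-- The Leray multiplier preserves purely imaginary vectors. [folklore] -/
theorem leraySym_re_eq_zero (k : Fin 3 → ℤ) {w : EuclideanSpace ℂ (Fin 3)} (hw : ∀ j, (w j).re = 0) (j : Fin 3) :
    (leraySym k w j).re = 0 := by
  rw [leraySym_def]
  have hs : (∑ i, ((k i : ℤ) : ℂ) * w i).re = 0 := by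
    rw [Complex.re_sum]
    exact Finset.sum_eq_zero fun i _ => by simp [Complex.mul_re, hw i]
  simp only [PiLp.sub_apply, PiLp.smul_apply, freqVec_apply, smul_eq_mul, Complex.sub_re, hw j,
    Complex.mul_re, Complex.div_re, Complex.ofReal_re, Complex.ofReal_im, Complex.intCast_re,
    Complex.intCast_im, hs]
  ring

/-- The convection symbol of purely imaginary families is purely imaginary
(`(2πi)(i·real) = real`). [folklore] -/
theorem convectionCoeff_re_eq_zero {S : Finset (Fin 3 → ℤ)} {c c' : (Fin 3 → ℤ) → EuclideanSpace ℂ (Fin 3)}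
    (hc : ∀ l j, (c l j).re = 0) (hc' : ∀ m j, (c' m j).re = 0) (k : Fin 3 → ℤ) (j : Fin 3) :
    (convectionCoeff S c c' k j).re = 0 := by
  rw [convectionCoeff_def]
  simp only [WithLp.ofLp_sum, Finset.sum_apply, Complex.re_sum]
  refine Finset.sum_eq_zero fun l _ => Finset.sum_eq_zero fun m _ => ?_
  split_ifs
  · have hs : (∑ i, c l i * ((m i : ℤ) : ℂ)).re = 0 := by
      rw [Complex.re_sum]
      exact Finset.sum_eq_zero fun i _ => by simp [Complex.mul_re, hc l i]
    simp only [PiLp.smul_apply, smul_eq_mul, Complex.mul_re, Complex.mul_im, Complex.I_re, Complex.I_im,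
      Complex.ofReal_re, Complex.ofReal_im, hs, hc' m j, Complex.re_ofNat, Complex.im_ofNat]
    ring
  · rfl

/-- The Galerkin field of purely imaginary data (force and state) is purely imaginary. [folklore] -/
theorem galerkinField_re_eq_zero (ν : ℝ) {S : Finset (Fin 3 → ℤ)} {g c : (Fin 3 → ℤ) → EuclideanSpace ℂ (Fin 3)}
    (hg : ∀ l j, (g l j).re = 0) (hc : ∀ l j, (c l j).re = 0) (k : Fin 3 → ℤ) (j : Fin 3) :
    (galerkinField ν S g c k j).re = 0 := by
  rw [galerkinField_def, PiLp.add_apply, Complex.add_re, PiLp.neg_apply, Complex.neg_re, PiLp.smul_apply,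
    smul_eq_mul, Complex.mul_re, Complex.ofReal_re, Complex.ofReal_im, hc k j]
  have h2 : (leraySym k (g k - convectionCoeff S c c k) j).re = 0 :=
    leraySym_re_eq_zero k (fun i => by
      rw [PiLp.sub_apply, Complex.sub_re, hg k i, convectionCoeff_re_eq_zero hc hc k i, sub_zero]) j
  rw [h2]; ring

/-- Sums of lattice modes stay on the lattice (or hit the mean mode). [folklore] -/
theorem add_mem_obliqueModes_or {N : ℕ} {l m : Fin 3 → ℤ} (hl : l ∈ obliqueModes N) (hm : m ∈ obliqueModes N)
    (hk : l + m ∈ freqBall (d := Fin 3) N) : l + m ∈ obliqueModes N ∨ l + m = 0 := by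
  obtain ⟨_, _, hl02, hle⟩ := mem_obliqueModes.1 hl
  obtain ⟨_, _, hm02, hme⟩ := mem_obliqueModes.1 hm
  by_cases h0 : l + m = 0
  · exact Or.inr h0
  · exact Or.inl (mem_obliqueModes.2 ⟨hk, h0, by simp [hl02, hm02], by simpa using hle.add hme⟩)

/-- **The convection symbol of oblique data vanishes off the lattice** (a convolution of
lattice-supported families lives on the lattice; at the mean mode it vanishes by transversality).
[folklore] -/
theorem convectionCoeff_obliqueCoeff_eq_zero {N : ℕ} (x y : ObliqueIndex N → ℝ) {k : Fin 3 → ℤ}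
    (hkS : k ∈ freqBall (d := Fin 3) N) (hk : k ∉ obliqueModes N) :
    convectionCoeff (freqBall (d := Fin 3) N) (coeffExt (freqBall (d := Fin 3) N) (obliqueCoeff N x))
      (coeffExt (freqBall (d := Fin 3) N) (obliqueCoeff N y)) k = 0 := by
  refine convectionCoeff_eq_zero_of_forall fun l hl m hm hlm => ?_
  rw [coeffExt_of_mem _ hl, coeffExt_of_mem _ hm]
  by_cases hlL : l ∈ obliqueModes N
  · by_cases hmL : m ∈ obliqueModes N
    · -- both on the lattice: then `k = 0`, `m = -l`, and the scalar is `-(l · c l) = 0`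
      rcases add_mem_obliqueModes_or hlL hmL (hlm ▸ hkS) with h | h
      · exact absurd (hlm ▸ h) hk
      · have hml : m = -l := by
          have := congrArg (fun t => t - l) h
          simpa [add_sub_cancel_left, zero_sub, add_comm] using this
        have htr := isSolenoidalCoeff_obliqueCoeff x ⟨l, hl⟩
        have : ∑ j, obliqueCoeff N x ⟨l, hl⟩ j * ((m j : ℤ) : ℂ) = 0 := by
          rw [hml]
          simp only [Pi.neg_apply, Int.cast_neg, mul_neg, Finset.sum_neg_distrib, neg_eq_zero]
          rw [← htr]
          exact Finset.sum_congr rfl fun j _ => mul_comm _ _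
        rw [this, zero_smul]
    · rw [obliqueCoeff_apply_of_not_mem y (k := ⟨m, hm⟩) hmL, smul_zero]
  · have : obliqueCoeff N x ⟨l, hl⟩ = 0 := obliqueCoeff_apply_of_not_mem x (k := ⟨l, hl⟩) hlL
    rw [this]
    simp

/-- **The Galerkin field of oblique data vanishes off the lattice** (`N ≥ 2`). [folklore] -/
theorem galerkinRHS_obliqueCoeff_eq_zero {N : ℕ} (hN : 2 ≤ N) (ν F : ℝ) (x : ObliqueIndex N → ℝ)
    {k : ↥(freqBall (d := Fin 3) N)} (hk : (k : Fin 3 → ℤ) ∉ obliqueModes N) :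
    galerkinRHS (freqBall (d := Fin 3) N) ν (kolmogorovCoeff F N) (obliqueCoeff N x) k = 0 := by
  have he := modeE_mem_obliqueModes hN
  have h1 : (k : Fin 3 → ℤ) ≠ modeE := fun h => hk (h ▸ he)
  have h2 : (k : Fin 3 → ℤ) ≠ -modeE := fun h => hk (h ▸ neg_mem_obliqueModes he)
  rw [galerkinRHS_apply, galerkinField_def, convectionCoeff_obliqueCoeff_eq_zero x x k.2 hk,
    coeffExt_of_mem _ k.2, coeffExt_of_mem _ k.2]
  simp [obliqueCoeff_apply_of_not_mem x hk, kolmogorovCoeff_eq_zero F h1 h2]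

/-- Symmetry of the frequency ball in the form consumed by the Galerkin API. [folklore] -/
theorem freqBall_symm (N : ℕ) : ∀ k ∈ freqBall (d := Fin 3) N, -k ∈ freqBall (d := Fin 3) N :=
  fun _ hk => neg_mem_freqBall.2 hk

/-- **Reconstruction**: a purely imaginary, real, transversal coefficient vector supported on the
lattice is `Φ` of its oblique coordinates (the polarisation basis and `k/|k|` form an orthonormal
basis of `ℝ³`). [folklore] -/
theorem obliqueCoeff_obliqueCoord {N : ℕ} {v : ↥(freqBall (d := Fin 3) N) → EuclideanSpace ℂ (Fin 3)}
    (hsupp : ∀ k : ↥(freqBall (d := Fin 3) N), (k : Fin 3 → ℤ) ∉ obliqueModes N → v k = 0)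
    (hreal : IsRealCoeff v) (hsol : IsSolenoidalCoeff v) (him : ∀ k j, (v k j).re = 0) :
    obliqueCoeff N (obliqueCoord N v) = v := by
  -- the key reconstruction on a representative
  have key : ∀ (k : ↥(freqBall (d := Fin 3) N)) (hk : (k : Fin 3 → ℤ) ∈ obliqueReps N),
      Complex.I • EuclideanSpace.complexify
        (∑ σ : Fin 2, obliqueCoord N v (⟨(k : Fin 3 → ℤ), hk⟩, σ) • basisVec (k : Fin 3 → ℤ) σ) = v k := by
    intro k hk
    have hkm : (k : Fin 3 → ℤ) ∈ obliqueModes N := obliqueReps_subset N hk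
    obtain ⟨_, h0, h02, _⟩ := mem_obliqueModes.1 hkm
    have hq := freqNormSq_eq_of_mem hkm
    have hpos := freqNormSq_pos_of_mem hkm
    set k' : ↥(freqBall (d := Fin 3) N) := ⟨(k : Fin 3 → ℤ), mem_freqBall_of_mem_obliqueReps hk⟩ with hk'
    have hkk : v k = v k' := by rw [hk']
    -- transversality of the imaginary parts
    have htr : ((k : Fin 3 → ℤ) 0 : ℝ) * (v k' 0).im + ((k : Fin 3 → ℤ) 1 : ℝ) * (v k' 1).im +
        ((k : Fin 3 → ℤ) 0 : ℝ) * (v k' 2).im = 0 := by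
      have h := congrArg Complex.im (hsol k')
      rw [Complex.im_sum, Fin.sum_univ_three] at h
      simp only [Complex.mul_im, Complex.intCast_re, Complex.intCast_im, zero_mul, add_zero,
        Complex.zero_im] at h
      have h02' : (k' : Fin 3 → ℤ) 2 = (k : Fin 3 → ℤ) 0 := h02.symm
      rw [h02'] at h
      exact h
    -- the vector identity, coordinatewise
    have hvec : (∑ σ : Fin 2, obliqueCoord N v (⟨(k : Fin 3 → ℤ), hk⟩, σ) • basisVec (k : Fin 3 → ℤ) σ) =
        (WithLp.toLp 2 fun j => (v k' j).im : EuclideanSpace ℝ (Fin 3)) := by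
      have hs2 : Real.sqrt 2 ^ 2 = 2 := Real.sq_sqrt (by norm_num)
      have hsq : Real.sqrt (freqNormSq (k : Fin 3 → ℤ)) ^ 2 = freqNormSq (k : Fin 3 → ℤ) := Real.sq_sqrt hpos.le
      have hne1 : Real.sqrt 2 ≠ 0 := by positivity
      have hne2 : Real.sqrt (freqNormSq (k : Fin 3 → ℤ)) ≠ 0 := by positivity
      rw [Fin.sum_univ_two]
      simp only [obliqueCoord, basisVec, Fin.isValue, if_true, one_ne_zero, if_false, Fin.sum_univ_three, ← hk']
      ext j
      fin_cases j
      · simp only [PiLp.add_apply, PiLp.smul_apply, smul_eq_mul, inVec_apply_zero, inVec_apply_one,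
          inVec_apply_two, perpVec_apply_zero, perpVec_apply_one, perpVec_apply_two, Fin.isValue,
          Fin.zero_eta]
        field_simp
        rw [hs2, hsq, hq]
        linear_combination (-2 * ((k : Fin 3 → ℤ) 0 : ℝ)) * htr
      · simp only [PiLp.add_apply, PiLp.smul_apply, smul_eq_mul, inVec_apply_zero, inVec_apply_one,
          inVec_apply_two, perpVec_apply_zero, perpVec_apply_one, perpVec_apply_two, Fin.isValue,
          Fin.mk_one]
        field_simp
        rw [hs2, hsq, hq]
        linear_combination (-2 * ((k : Fin 3 → ℤ) 1 : ℝ)) * htr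
      · simp only [PiLp.add_apply, PiLp.smul_apply, smul_eq_mul, inVec_apply_zero, inVec_apply_one,
          inVec_apply_two, perpVec_apply_zero, perpVec_apply_one, perpVec_apply_two, Fin.isValue,
          Fin.reduceFinMk]
        field_simp
        rw [hs2, hsq, hq]
        linear_combination (-2 * ((k : Fin 3 → ℤ) 0 : ℝ)) * htr
    rw [hvec, hkk]
    ext j
    apply Complex.ext
    · simp [EuclideanSpace.complexify_apply, him k' j]
    · simp [EuclideanSpace.complexify_apply]
  funext k
  by_cases hk : (k : Fin 3 → ℤ) ∈ obliqueReps N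
  · rw [obliqueCoeff_apply_of_mem _ hk]
    exact key k hk
  · by_cases hk' : -(k : Fin 3 → ℤ) ∈ obliqueReps N
    · rw [obliqueCoeff_apply_of_neg_mem _ hk']
      have hnk : -(k : Fin 3 → ℤ) ∈ freqBall (d := Fin 3) N := neg_mem_freqBall.2 k.2
      have h := key ⟨-(k : Fin 3 → ℤ), hnk⟩ hk'
      rw [h, hreal ⟨-(k : Fin 3 → ℤ), hnk⟩ k (by simp)]
      ext j
      apply Complex.ext
      · simp [EuclideanSpace.conjVec_apply, him]
      · simp [EuclideanSpace.conjVec_apply]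
    · rw [hsupp k fun h => (mem_obliqueReps_or_neg_mem h).elim hk hk']
      exact obliqueCoeff_apply_of_not_mem _ fun h => (mem_obliqueReps_or_neg_mem h).elim hk hk'

/-- **Invariance of the oblique class** under the Galerkin vector field: for `N ≥ 2`,
`galerkinRHS (Φ x) = Φ (Ψ (galerkinRHS (Φ x)))`. [folklore] -/
theorem obliqueCoeff_obliqueCoord_galerkinRHS {N : ℕ} (hN : 2 ≤ N) (ν F : ℝ) (x : ObliqueIndex N → ℝ) :
    obliqueCoeff N (obliqueCoord N (galerkinRHS (freqBall (d := Fin 3) N) ν (kolmogorovCoeff F N) (obliqueCoeff N x))) =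
      galerkinRHS (freqBall (d := Fin 3) N) ν (kolmogorovCoeff F N) (obliqueCoeff N x) := by
  have hmem := galerkinRHS_mem ν (freqBall_symm N) (isRealCoeff_kolmogorovCoeff F N) (obliqueCoeff_mem x)
  refine obliqueCoeff_obliqueCoord (fun k hk => galerkinRHS_obliqueCoeff_eq_zero hN ν F x hk) hmem.1 hmem.2
    fun k j => ?_
  rw [galerkinRHS_apply]
  refine galerkinField_re_eq_zero ν (fun l i => ?_) (fun l i => ?_) _ j
  · by_cases hl : l ∈ freqBall (d := Fin 3) N
    · rw [coeffExt_of_mem _ hl]; exact kolmogorovCoeff_re F ⟨l, hl⟩ i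
    · rw [coeffExt_of_not_mem _ hl]; rfl
  · by_cases hl : l ∈ freqBall (d := Fin 3) N
    · rw [coeffExt_of_mem _ hl]; exact obliqueCoeff_re x ⟨l, hl⟩ i
    · rw [coeffExt_of_not_mem _ hl]; rfl

/-- **Zeros of `obliqueField` are stationary Galerkin states**: if `obliqueField ν F N x = 0`
(`N ≥ 2`) then `galerkinRHS (freqBall N) ν f̂ (Φ x) = 0`. [folklore] -/
theorem galerkinRHS_eq_zero_of_obliqueField_eq_zero {N : ℕ} (hN : 2 ≤ N) {ν F : ℝ} {x : ObliqueIndex N → ℝ}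
    (hx : obliqueField ν F N x = 0) :
    galerkinRHS (freqBall (d := Fin 3) N) ν (kolmogorovCoeff F N) (obliqueCoeff N x) = 0 := by
  have h0 : obliqueCoord N (galerkinRHS (freqBall (d := Fin 3) N) ν (kolmogorovCoeff F N) (obliqueCoeff N x)) = 0 := by
    have := congrArg Neg.neg hx
    rwa [obliqueField_apply, neg_neg, neg_zero] at this
  rw [← obliqueCoeff_obliqueCoord_galerkinRHS hN ν F x, h0]
  funext k
  by_cases hk : (k : Fin 3 → ℤ) ∈ obliqueReps N
  · rw [obliqueCoeff_apply_of_mem _ hk]; simp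
  · by_cases hk' : -(k : Fin 3 → ℤ) ∈ obliqueReps N
    · rw [obliqueCoeff_apply_of_neg_mem _ hk']; simp
    · exact obliqueCoeff_apply_of_not_mem _ fun h => (mem_obliqueReps_or_neg_mem h).elim hk hk'

end Summit.AnomalousDissipation.AnomalousDissipation.Theorems.Oblique

end
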